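import Summits.CriticalPhenomena.CardyFormulaZ2.Theorems.CardyFlipRussoCoveringLegStubCoveringBridgeDict
import Literature.Probability.Percolation.SiteConnectionTools
import HarnessLib

/-!
# Kesten's covering coupling at `q = 0` (stub `stub_coveringBridge`, line `five-arm-null`, crux `CoveringLeg`)

Helper file `--supports stmt-CriticalPhenomena-6435` (stub `stub_coveringBridge` = `CardySectorGap.CoveringBridge`,
stmt-CriticalPhenomena-7055).  THE EXACT COUPLING: pushing critical bond percolation on `ℤ²`
(`bondPercolation (zdGraph 2) half`) forward along Kesten's covering map `coverMap`
(`…StubCoveringBridgeDict.lean`: the type-I site `inl x` is open iff its `ℤ²`-edge `coverEdge x` is open,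
type-II centres closed, type-III centres open) gives EXACTLY Beffara's mixed law at `q = 0`,
`prodBernoulli (mixedParam 0)` (`cover_map_bondPercolation`); hence every measurable event of the mixed
model at `q = 0` has the bond-`ℤ²` probability of its preimage (`cover_real_preimage`).  The proof is
uniqueness of infinite product measures from boxes (`Measure.eq_infinitePi`): an injective reindexing of an
infinite product is the reindexed product (`cover_infinitePi_map_reindex`), and coordinatewise maps act
factorwise (`Measure.infinitePi_map_pi`).  (Beffara 2008 §5.1: "if `q = 0` […] mixed percolation then
corresponds to critical bond-percolation on the square lattice"; Kesten 1982 §3.4, covering graphs.)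
Also here: the window `{y | δ·z y ∈ Ω}` is FINITE for bounded `Ω` and `δ ≠ 0` (`cover_window_finite`, the
finite-support lemma of the line) and the crude site crossing event is then measurable
(`cover_measurableSet_siteCross`).
-/

noncomputable section

namespace Summit.CriticalPhenomena.CardyFormulaZ2.Cruxes.CoveringLeg.FiveArmNull

open MeasureTheory Measure ProbabilityTheory unitInterval
open Literature.Probability.LatticeModels
open Literature.Probability.Percolation
open Literature.Barriers.CriticalPhenomena (MixedSite mixedParam)
open Literature.Computability.QuantumComplexity.Lemma24 (sqrt2_ne_zero)


/-! ### Injective reindexing of an infinite product measure -/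

/-- **Injective reindexing of an infinite product.** For an injective `ρ : α → ι`, reading the coordinates
`ρ a` of a sample of `⨂ᵢ μ i` gives a sample of `⨂ₐ μ (ρ a)` (distinct coordinates stay independent):
uniqueness of product measures from their values on boxes (`Measure.eq_infinitePi`); the case of a
bijection is Mathlib's `infinitePi_map_piCongrLeft`. [folklore] -/
theorem cover_infinitePi_map_reindex {ι α X : Type*} [MeasurableSpace X] (μ : ι → Measure X)
    [∀ i, IsProbabilityMeasure (μ i)] {ρ : α → ι} (hρ : Function.Injective ρ) :
    (infinitePi μ).map (fun (χ : ι → X) (a : α) => χ (ρ a)) = infinitePi (fun a => μ (ρ a)) := by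
  classical
  have hm : Measurable (fun (χ : ι → X) (a : α) => χ (ρ a)) :=
    measurable_pi_lambda _ fun a => measurable_pi_apply (ρ a)
  refine eq_infinitePi _ fun s t ht => ?_
  rw [Measure.map_apply hm (MeasurableSet.pi s.countable_toSet fun a _ => ht a)]
  set t' : ι → Set X := fun i => if h : ∃ a ∈ s, ρ a = i then t h.choose else Set.univ with ht'
  have ht'e : ∀ a ∈ s, t' (ρ a) = t a := by
    intro a ha
    have h : ∃ a' ∈ s, ρ a' = ρ a := ⟨a, ha, rfl⟩
    simp only [ht', dif_pos h]
    rw [hρ h.choose_spec.2]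
  have hpre : (fun (χ : ι → X) (a : α) => χ (ρ a)) ⁻¹' Set.pi (↑s) t =
      Set.pi (↑(s.map ⟨ρ, hρ⟩)) t' := by
    ext χ
    simp only [Set.mem_preimage, Set.mem_pi, Finset.mem_coe, Finset.mem_map,
      Function.Embedding.coeFn_mk, forall_exists_index, and_imp]
    constructor
    · rintro h i a ha rfl
      rw [ht'e a ha]
      exact h a ha
    · intro h a ha
      have := h (ρ a) a ha rfl
      rwa [ht'e a ha] at this
  rw [hpre, infinitePi_pi _ (fun i _ => ?_), Finset.prod_map]
  · exact Finset.prod_congr rfl fun a ha => by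
      simp only [Function.Embedding.coeFn_mk]
      rw [ht'e a ha]
  · simp only [ht']
    split_ifs
    · exact ht _
    · exact MeasurableSet.univ

/-! ### The coupling -/

/-- The coordinate map behind `coverMap` on `Prop`-valued configurations: read the coordinate
`coverEdge x` at `inl x`, the constant `¬ Even (f.1 + f.2)` at `inr f`. [cite: Beffara2008Universal, §5.1] -/
theorem cover_coverMap_comp_setOf :
    coverMap ∘ (fun p : Sym2 (Site 2) → Prop => {e | p e}) =
      (fun q : MixedSite → Prop => {v | q v}) ∘
        (fun (χ : Sym2 (Site 2) → Prop) (v : MixedSite) =>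
          Sum.elim (fun x : ℤ × ℤ => χ (coverEdge x)) (fun f : ℤ × ℤ => ¬ Even (f.1 + f.2)) v) := by
  funext χ
  ext v
  cases v <;> rfl

/-- **Kesten's covering coupling (Beffara 2008 §5.1, Kesten 1982 §3.4).** The image of critical bond
percolation on `ℤ²` under the covering map is Beffara's mixed percolation `P_{1/2,0}` on `G_s`: type-I
sites are independent fair coins (one per `ℤ²`-edge, `coverEdge` injective into the edge set), type-II
centres are a.s. closed (`mixedParam 0 = 0` there) and type-III centres a.s. open (`1 - 0 = 1`).
[cite: Beffara2008Universal, §5.1] -/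
theorem cover_map_bondPercolation : (Literature.Probability.Percolation.bondPercolation (Literature.Probability.LatticeModels.zdGraph 2) Literature.Probability.Percolation.half).map Summit.CriticalPhenomena.CardyFormulaZ2.Cruxes.CoveringLeg.FiveArmNull.coverMap = Literature.Probability.LatticeModels.prodBernoulli (Literature.Barriers.CriticalPhenomena.mixedParam 0) := by
  classical
  -- an auxiliary injective reading map `ρ` (diagonal junk coordinates at the face centres)
  let ρ : MixedSite → Sym2 (Site 2) := fun v =>
    Sum.elim (fun x : ℤ × ℤ => coverEdge x) (fun f : ℤ × ℤ => s(![f.1, f.2], ![f.1, f.2])) v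
  let g : MixedSite → Prop → Prop := fun v b =>
    Sum.elim (fun _ : ℤ × ℤ => b) (fun f : ℤ × ℤ => ¬ Even (f.1 + f.2)) v
  have hdiag : ∀ f : ℤ × ℤ, Sym2.IsDiag (s(![f.1, f.2], ![f.1, f.2]) : Sym2 (Site 2)) :=
    fun f => (Sym2.mk_isDiag_iff).2 rfl
  have hρ : Function.Injective ρ := by
    intro v w h
    cases v with
    | inl x =>
      cases w with
      | inl y => exact congrArg Sum.inl (coverEdge_injective h)
      | inr f =>
        have h2 : (coverEdge x).IsDiag := by
          change (ρ (Sum.inl x)).IsDiag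
          rw [h]
          exact hdiag f
        exact absurd (Sym2.mk_isDiag_iff.1 h2) (coverFst_ne_coverSnd x)
    | inr f =>
      cases w with
      | inl y =>
        have h2 : (coverEdge y).IsDiag := by
          change (ρ (Sum.inl y)).IsDiag
          rw [← h]
          exact hdiag f
        exact absurd (Sym2.mk_isDiag_iff.1 h2) (coverFst_ne_coverSnd y)
      | inr f' =>
        have h1 : (![f.1, f.2] : Site 2) = ![f'.1, f'.2] := by
          have := Sym2.eq_iff.1 h
          tauto
        have e1 := congrFun h1 0
        have e2 := congrFun h1 1
        simp only [Matrix.cons_val_zero, Matrix.cons_val_one] at e1 e2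
        exact congrArg Sum.inr (Prod.ext e1 e2)
  have hg : ∀ v, Measurable (g v) := fun _ _ _ => MeasurableSpace.measurableSet_top
  have hreindex : Measurable (fun (χ : Sym2 (Site 2) → Prop) (v : MixedSite) => χ (ρ v)) :=
    measurable_pi_lambda _ fun v => measurable_pi_apply (ρ v)
  have hcoord : Measurable (fun (χ : MixedSite → Prop) (v : MixedSite) => g v (χ v)) :=
    measurable_pi_lambda _ fun v => (hg v).comp (measurable_pi_apply v)
  have hT : (fun (χ : Sym2 (Site 2) → Prop) (v : MixedSite) =>
        Sum.elim (fun x : ℤ × ℤ => χ (coverEdge x)) (fun f : ℤ × ℤ => ¬ Even (f.1 + f.2)) v) =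
      (fun (χ : MixedSite → Prop) (v : MixedSite) => g v (χ v)) ∘
        (fun (χ : Sym2 (Site 2) → Prop) (v : MixedSite) => χ (ρ v)) := by
    funext χ v
    cases v <;> rfl
  rw [bondPercolation, setBernoulli_eq_map, prodBernoulli_eq_map,
    Measure.map_map measurable_coverMap measurable_setOf, cover_coverMap_comp_setOf,
    ← Measure.map_map measurable_setOf (hT ▸ hcoord.comp hreindex)]
  congr 1
  change (infinitePi fun e : Sym2 (Site 2) =>
      (Ber(e ∈ (zdGraph 2).edgeSet, False, half) : Measure Prop)).map _ =
    infinitePi fun v : MixedSite => (Ber(True, False, mixedParam 0 v) : Measure Prop)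
  rw [hT, ← Measure.map_map hcoord hreindex, cover_infinitePi_map_reindex _ hρ]
  have hpi := infinitePi_map_pi
    (μ := fun v : MixedSite => (Ber(ρ v ∈ (zdGraph 2).edgeSet, False, half) : Measure Prop))
    (f := g) hg
  refine hpi.trans ?_
  congr 1
  funext v
  cases v with
  | inl x =>
    have hx : (coverEdge x ∈ (zdGraph 2).edgeSet) = True := eq_true (coverEdge_mem_edgeSet x)
    simp only [g, ρ, Sum.elim_inl, Measure.map_id', hx]
    rfl
  | inr f =>
    simp only [g, ρ, Sum.elim_inr, Measure.map_const, measure_univ, one_smul, mixedParam]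
    by_cases hf : Even (f.1 + f.2)
    · simp [hf]
    · simp [hf]

/-- Consequently every measurable event `A` of the mixed model at `q = 0` has the bond-`ℤ²` probability of
its covering preimage: `P_{1/2,0}(A) = P^{bond}_{1/2}(coverMap ⁻¹ A)`. [cite: Beffara2008Universal, §5.1] -/
theorem cover_real_preimage {A : Set (Set MixedSite)} (hA : MeasurableSet A) :
    (prodBernoulli (mixedParam 0)).real A =
      (bondPercolation (zdGraph 2) half).real (coverMap ⁻¹' A) := by
  rw [← cover_map_bondPercolation, measureReal_def, measureReal_def,
    Measure.map_apply measurable_coverMap hA]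

/-- Without measurability one inequality survives: `P^{bond}_{1/2}(coverMap ⁻¹ A) ≤ P_{1/2,0}(A)`
(`Measure.le_map_apply`). [folklore] -/
theorem cover_real_preimage_le (A : Set (Set MixedSite)) :
    (bondPercolation (zdGraph 2) half).real (coverMap ⁻¹' A) ≤ (prodBernoulli (mixedParam 0)).real A := by
  rw [← cover_map_bondPercolation, measureReal_def, measureReal_def]
  exact ENNReal.toReal_mono (measure_ne_top _ _)
    (Measure.le_map_apply measurable_coverMap.aemeasurable A)

/-! ### Finiteness of the window and measurability of the crude site event -/

/-- The Gaussian-integer coordinates of `√2 · coverZ`: an injective map `G_s → ℤ²`. [cite: Beffara2008Universal, §5.1] -/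
theorem cover_z_eq_coord (y : MixedSite) :
    coverZ y = ((((Sum.elim (fun x : ℤ × ℤ => (x.1 + x.2, x.2 - x.1 + 1))
        (fun f : ℤ × ℤ => (f.1 + f.2 + 1, f.2 - f.1 + 1)) y).1 : ℤ) : ℂ) +
      (((Sum.elim (fun x : ℤ × ℤ => (x.1 + x.2, x.2 - x.1 + 1))
        (fun f : ℤ × ℤ => (f.1 + f.2 + 1, f.2 - f.1 + 1)) y).2 : ℤ) : ℂ) * Complex.I) /
        (Real.sqrt 2 : ℂ) := by
  cases y <;> simp [coverZ]

/-- The coordinate map is injective (parities separate sites from centres). [cite: Beffara2008Universal, §5.1] -/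
theorem cover_coord_injective :
    Function.Injective (fun y : MixedSite => Sum.elim (fun x : ℤ × ℤ => (x.1 + x.2, x.2 - x.1 + 1))
      (fun f : ℤ × ℤ => (f.1 + f.2 + 1, f.2 - f.1 + 1)) y) := by
  intro y y' h
  cases y with
  | inl x =>
    cases y' with
    | inl x' =>
      obtain ⟨a, b⟩ := x; obtain ⟨c, d⟩ := x'
      simp only [Sum.elim_inl, Prod.mk.injEq] at h
      have : a = c ∧ b = d := by omega
      rw [this.1, this.2]
    | inr f =>
      obtain ⟨a, b⟩ := x; obtain ⟨c, d⟩ := f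
      simp only [Sum.elim_inl, Sum.elim_inr, Prod.mk.injEq] at h
      omega
  | inr f =>
    cases y' with
    | inl x' =>
      obtain ⟨a, b⟩ := f; obtain ⟨c, d⟩ := x'
      simp only [Sum.elim_inl, Sum.elim_inr, Prod.mk.injEq] at h
      omega
    | inr f' =>
      obtain ⟨a, b⟩ := f; obtain ⟨c, d⟩ := f'
      simp only [Sum.elim_inr, Prod.mk.injEq] at h
      have : a = c ∧ b = d := by omega
      rw [this.1, this.2]

/-- **The window is finite**: for a bounded `Ω` and `δ ≠ 0` only finitely many vertices of `G_s` are drawn in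
`Ω` at mesh `δ` (their Gaussian-integer coordinates are bounded). This is the finite-support lemma of the
line (the crude event and the pivotal masses only see these sites). [folklore] -/
theorem cover_window_finite {Ω : Set ℂ} (hΩ : Bornology.IsBounded Ω) {δ : ℝ} (hδ : δ ≠ 0) :
    {y : MixedSite | (δ : ℂ) * coverZ y ∈ Ω}.Finite := by
  obtain ⟨r, hr⟩ := hΩ.subset_closedBall 0
  set κ : MixedSite → ℤ × ℤ := fun y => Sum.elim (fun x : ℤ × ℤ => (x.1 + x.2, x.2 - x.1 + 1))
      (fun f : ℤ × ℤ => (f.1 + f.2 + 1, f.2 - f.1 + 1)) y with hκ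
  set N : ℤ := ⌈Real.sqrt 2 * r / |δ|⌉ with hN
  have hsub : {y : MixedSite | (δ : ℂ) * coverZ y ∈ Ω} ⊆ κ ⁻¹' (Set.Icc (-N) N ×ˢ Set.Icc (-N) N) := by
    intro y hy
    have hyr : ‖(δ : ℂ) * coverZ y‖ ≤ r := by
      have := hr hy
      rwa [Metric.mem_closedBall, dist_zero_right] at this
    have hδpos : 0 < |δ| := abs_pos.2 hδ
    have hs2 : (0 : ℝ) < Real.sqrt 2 := Real.sqrt_pos.2 (by norm_num)
    -- `√2 · coverZ y = κ₁ + κ₂ i`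
    have hw : (Real.sqrt 2 : ℂ) * coverZ y = ((κ y).1 : ℂ) + ((κ y).2 : ℂ) * Complex.I := by
      rw [cover_z_eq_coord, mul_div_cancel₀ _ sqrt2_ne_zero]
    have hnorm : ‖((κ y).1 : ℂ) + ((κ y).2 : ℂ) * Complex.I‖ ≤ Real.sqrt 2 * r / |δ| := by
      rw [← hw, norm_mul, Complex.norm_real, Real.norm_of_nonneg hs2.le, le_div_iff₀ hδpos]
      rw [norm_mul, Complex.norm_real, Real.norm_eq_abs] at hyr
      nlinarith
    have hre : |((κ y).1 : ℝ)| ≤ Real.sqrt 2 * r / |δ| := by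
      have := Complex.abs_re_le_norm (((κ y).1 : ℂ) + ((κ y).2 : ℂ) * Complex.I)
      have h' : (((κ y).1 : ℂ) + ((κ y).2 : ℂ) * Complex.I).re = ((κ y).1 : ℝ) := by simp
      rw [h'] at this
      exact this.trans hnorm
    have him : |((κ y).2 : ℝ)| ≤ Real.sqrt 2 * r / |δ| := by
      have := Complex.abs_im_le_norm (((κ y).1 : ℂ) + ((κ y).2 : ℂ) * Complex.I)
      have h' : (((κ y).1 : ℂ) + ((κ y).2 : ℂ) * Complex.I).im = ((κ y).2 : ℝ) := by simp
      rw [h'] at this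
      exact this.trans hnorm
    have hbound : ∀ m : ℤ, |(m : ℝ)| ≤ Real.sqrt 2 * r / |δ| → m ∈ Set.Icc (-N) N := by
      intro m hm
      rw [abs_le] at hm
      have h1 : (m : ℝ) ≤ N := hm.2.trans (Int.le_ceil _)
      have h2 : (-N : ℝ) ≤ m := by
        have := Int.le_ceil (Real.sqrt 2 * r / |δ|)
        rw [hN]; linarith
      exact ⟨by exact_mod_cast h2, by exact_mod_cast h1⟩
    exact ⟨hbound _ hre, hbound _ him⟩
  refine Set.Finite.subset (Set.Finite.preimage (cover_coord_injective.injOn) ?_) hsub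
  exact (Set.finite_Icc _ _).prod (Set.finite_Icc _ _)

/-- The crude site crossing event is measurable as soon as its window is finite (a countable union over the
endpoints of the cylinder events `siteConnIn`, `measurableSet_siteConnIn`). [folklore] -/
theorem cover_measurableSet_siteEmbDomainCrossing {V : Type*} [Countable V] (G : SimpleGraph V)
    (z : V → ℂ) (Ω : Set ℂ) (δ : ℝ) (A B : Set ℂ) (hW : {y : V | (δ : ℂ) * z y ∈ Ω}.Finite) :
    MeasurableSet (siteEmbDomainCrossing G z Ω δ A B) := by
  have h : siteEmbDomainCrossing G z Ω δ A B = ⋃ u : V, ⋃ v : V,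
      ({ω : SiteConfig V | Metric.infDist ((δ : ℂ) * z u) A ≤ 2 * δ} ∩
        ({ω : SiteConfig V | Metric.infDist ((δ : ℂ) * z v) B ≤ 2 * δ} ∩
          siteConnIn G {y | (δ : ℂ) * z y ∈ Ω} u v)) := by
    ext ω
    simp only [mem_siteEmbDomainCrossing_iff, Set.mem_iUnion, Set.mem_inter_iff, Set.mem_setOf_eq]
  rw [h]
  refine MeasurableSet.iUnion fun u => MeasurableSet.iUnion fun v => ?_
  refine (MeasurableSet.const _).inter ((MeasurableSet.const _).inter ?_)
  rw [← hW.coe_toFinset]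
  exact measurableSet_siteConnIn G _ u v

/-- In particular the crude site crossing of a bounded `Ω` at mesh `δ ≠ 0` on `G_s` (frame `z` of CardySectorGap) is
measurable. [folklore] -/
theorem cover_measurableSet_siteCross {Ω : Set ℂ} (hΩ : Bornology.IsBounded Ω) {δ : ℝ} (hδ : δ ≠ 0)
    (A B : Set ℂ) : MeasurableSet (siteEmbDomainCrossing centredSquareGraph coverZ Ω δ A B) :=
  cover_measurableSet_siteEmbDomainCrossing _ _ _ _ _ _ (cover_window_finite hΩ hδ)

end Summit.CriticalPhenomena.CardyFormulaZ2.Cruxes.CoveringLeg.FiveArmNull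

end
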